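import Summits.QuantumFields.YangMills.Theses.PencilRigidity
import Literature.Analysis.FluidPDE.OctahedralSymmetry

/-!
# `ShellRigidity` — load-bearing hypotheses (negative knowledge for the crux, stmt-QuantumFields-11685)

Two hypotheses of `PencilRigidity.ShellRigidity` are shown to be indispensable by explicit kernels:

* `shellRigidity_false_without_B4` — drop hypercubic (`W(B₄)`) invariance and `K x = cos (x 2)` is a
  bounded continuous kernel, OS-positive across `x₀ = 0` AND across `x₀ = x₁` (both mirrors fix the
  coordinate `x₂`; `Σ cᵢcⱼ cos(aᵢ−aⱼ) = (Σ cᵢ cos aᵢ)² + (Σ cᵢ sin aᵢ)²`), which is not radial.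
* `shellRigidity_false_without_diag` — drop positivity across the diagonal mirror `x₀ = x₁` and the
  zoo kernel `K x = exp (−Σ_μ |x_μ|)` is `W(B₄)`-invariant, bounded, continuous, OS-positive across
  `x₀ = 0` (Gram matrix `(e^{−tᵢ}e^{−tⱼ}) ⊙ Π_{μ≥1} e^{−|aᵢμ−aⱼμ|}`, Schur products; the OU kernel
  `e^{−|s−t|} = e^{−s}·min(e^{2s},e^{2t})·e^{−t}` is PSD by `posSemidef_matrix_measure_inter`), yet
  `K(e₀) = e⁻¹ ≠ e^{−√2} = K((e₀+e₁)/√2)`.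

Ideators/planners may import this module; `ShellRigidityWithoutB4` / `ShellRigidityWithoutDiag` are the
crux with exactly one hypothesis deleted, everything else verbatim.
-/

namespace Summit.QuantumFields.YangMills.Theorems.ShellRigidity.Negative

open scoped BigOperators Matrix
open Literature.MathematicalPhysics.QuantumLattice
open Literature.Analysis.FluidPDE (IsSignedPermIsometry signedPermIsometry signedPermIsometry_apply)
open MeasureTheory Set

noncomputable section

local notation "E4" => EuclideanSpace ℝ (Fin 4)

/-- The diagonal swap `x ↦ (x¹, x⁰, x², x³)` fixes the coordinate `x₂`. -/
@[simp] theorem piLpCongrLeft_swap01_apply_two (u : E4) :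
    LinearIsometryEquiv.piLpCongrLeft 2 ℝ ℝ (Equiv.swap (0 : Fin 4) 1) u 2 = u 2 := by
  simp [LinearIsometryEquiv.piLpCongrLeft_apply, Equiv.swap_apply_def]

/-- Time reflection fixes the coordinate `x₂`. -/
@[simp] theorem timeReflection_four_apply_two (u : E4) : timeReflection 4 u 2 = u 2 := by
  rw [timeReflection_apply]; simp

/-! ## Hypercubic invariance is load-bearing -/

/-- The crux `ShellRigidity` with the hypercubic-invariance hypothesis (`K ∘ R = K` for signed
permutations `R`) DROPPED; everything else verbatim. -/
def ShellRigidityWithoutB4 : Prop :=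
  ∀ (K : E4 → ℝ), ContinuousOn K {x : E4 | x ≠ 0} →
    (∃ C η : ℝ, 0 < η ∧ ∀ x : E4, x ≠ 0 → |K x| ≤ C * (1 + ‖x‖ ^ (η - 10))) →
    (∀ (m : ℕ) (x : Fin m → E4) (c : Fin m → ℝ), (∀ i, 0 < x i 0) →
      0 ≤ ∑ i, ∑ j, c i * c j * K (timeReflection 4 (x i) - x j)) →
    (∀ (m : ℕ) (x : Fin m → E4) (c : Fin m → ℝ), (∀ i, x i 1 < x i 0) →
      0 ≤ ∑ i, ∑ j, c i * c j *
        K (LinearIsometryEquiv.piLpCongrLeft 2 ℝ ℝ (Equiv.swap (0 : Fin 4) 1) (x i) - x j)) →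
    ∀ (R : E4 ≃ₗᵢ[ℝ] E4) (x : E4), x ≠ 0 → K (R x) = K x

/-- Gram identity behind every `cos`-kernel:
`Σᵢⱼ cᵢ cⱼ cos(aᵢ − aⱼ) = (Σ cᵢ cos aᵢ)² + (Σ cᵢ sin aᵢ)² ≥ 0`. [folklore] -/
theorem sum_sum_mul_mul_cos_sub_nonneg {m : ℕ} (c a : Fin m → ℝ) :
    0 ≤ ∑ i, ∑ j, c i * c j * Real.cos (a i - a j) := by
  have h : ∑ i, ∑ j, c i * c j * Real.cos (a i - a j)
      = (∑ i, c i * Real.cos (a i)) * (∑ j, c j * Real.cos (a j))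
        + (∑ i, c i * Real.sin (a i)) * (∑ j, c j * Real.sin (a j)) := by
    rw [Finset.sum_mul_sum, Finset.sum_mul_sum, ← Finset.sum_add_distrib]
    refine Finset.sum_congr rfl fun i _ => ?_
    rw [← Finset.sum_add_distrib]
    refine Finset.sum_congr rfl fun j _ => ?_
    rw [Real.cos_sub]; ring
  rw [h]
  exact add_nonneg (mul_self_nonneg _) (mul_self_nonneg _)

/-- **Hypercubic invariance is load-bearing.** Witness `K x = cos (x 2)`: continuous, bounded by
`1 ≤ 1·(1 + ‖x‖^(1-10))`, OS-positive across `x₀ = 0` and across `x₀ = x₁` (both mirrors fix the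
coordinate `x₂`, and `cos (aᵢ − aⱼ)` is a Gram kernel), yet for the swap `R : e₀ ↔ e₂`,
`K (R (π e₀)) = cos π ≠ cos 0 = K (π e₀)`. Any proof of the crux must use `W(B₄)`-invariance. [folklore] -/
theorem shellRigidity_false_without_B4 : ¬ ShellRigidityWithoutB4 := by
  intro h
  set K : E4 → ℝ := fun x => Real.cos (x 2) with hK
  have hcont : ContinuousOn K {x : E4 | x ≠ 0} := by
    refine Continuous.continuousOn ?_
    exact Real.continuous_cos.comp (PiLp.continuous_apply 2 (fun _ : Fin 4 => ℝ) 2)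
  have hbd : ∃ C η : ℝ, 0 < η ∧ ∀ x : E4, x ≠ 0 → |K x| ≤ C * (1 + ‖x‖ ^ (η - 10)) := by
    refine ⟨1, 1, one_pos, fun x _ => ?_⟩
    have h1 : |Real.cos (x 2)| ≤ 1 := Real.abs_cos_le_one _
    have h2 : (0 : ℝ) ≤ ‖x‖ ^ ((1 : ℝ) - 10) := Real.rpow_nonneg (norm_nonneg _) _
    simp only [hK, one_mul]
    linarith
  have hpos0 : ∀ (m : ℕ) (x : Fin m → E4) (c : Fin m → ℝ), (∀ i, 0 < x i 0) →
      0 ≤ ∑ i, ∑ j, c i * c j * K (timeReflection 4 (x i) - x j) := by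
    intro m x c _
    have : ∀ i j, K (timeReflection 4 (x i) - x j) = Real.cos ((x i) 2 - (x j) 2) := by
      intro i j
      simp only [hK, PiLp.sub_apply, timeReflection_four_apply_two]
    simp only [this]
    exact sum_sum_mul_mul_cos_sub_nonneg c fun i => (x i) 2
  have hposD : ∀ (m : ℕ) (x : Fin m → E4) (c : Fin m → ℝ), (∀ i, x i 1 < x i 0) →
      0 ≤ ∑ i, ∑ j, c i * c j *
        K (LinearIsometryEquiv.piLpCongrLeft 2 ℝ ℝ (Equiv.swap (0 : Fin 4) 1) (x i) - x j) := by
    intro m x c _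
    have : ∀ i j, K (LinearIsometryEquiv.piLpCongrLeft 2 ℝ ℝ (Equiv.swap (0 : Fin 4) 1) (x i) - x j)
        = Real.cos ((x i) 2 - (x j) 2) := by
      intro i j
      simp only [hK, PiLp.sub_apply, piLpCongrLeft_swap01_apply_two]
    simp only [this]
    exact sum_sum_mul_mul_cos_sub_nonneg c fun i => (x i) 2
  -- the isometry swapping `e₀` and `e₂`, applied to `π e₀`
  let R : E4 ≃ₗᵢ[ℝ] E4 := LinearIsometryEquiv.piLpCongrLeft 2 ℝ ℝ (Equiv.swap (0 : Fin 4) 2)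
  let x : E4 := EuclideanSpace.single 0 Real.pi
  have hx : x ≠ 0 := by
    intro h0
    have : x 0 = 0 := by rw [h0]; rfl
    simp [x, Real.pi_ne_zero] at this
  have hRx : (R x) 2 = Real.pi := by simp [R, x]
  have hx2 : x 2 = 0 := by simp [x]
  have key := h K hcont hbd hpos0 hposD R x hx
  simp only [hK, hRx, hx2, Real.cos_pi, Real.cos_zero] at key
  norm_num at key

/-! ## The diagonal mirror is load-bearing (zoo kernel `exp (−‖x‖₁)`) -/

/-- The zoo kernel `Z1`: `K(x) = exp (−Σ_μ |x_μ|)`. -/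
def Kexp (x : E4) : ℝ := Real.exp (-∑ i, |x i|)

/-- `Σ_μ |x_μ|` is invariant under signed permutations of the coordinates. [folklore] -/
theorem sum_abs_signedPerm (σ : Equiv.Perm (Fin 4)) (s : Fin 4 → ℤˣ) (x : E4) :
    ∑ i, |signedPermIsometry σ s x i| = ∑ i, |x i| := by
  have h1 : ∀ j, |((s j : ℤ) : ℝ)| = 1 := fun j => by
    rcases Int.units_eq_one_or (s j) with h | h <;> simp [h]
  simp only [signedPermIsometry_apply, abs_mul, h1, one_mul]
  exact Equiv.sum_comp σ (fun i => |x i|)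

/-- **OU Gram lemma**: the matrix `exp (−|aᵢ − aⱼ|)` is positive semidefinite
(`e^{−|s−t|} = e^{−s} · min(e^{2s}, e^{2t}) · e^{−t}` and the `min`-kernel is a Gram matrix of
indicators, `MeasureTheory.posSemidef_matrix_measure_inter`). [folklore] -/
theorem posSemidef_exp_neg_abs_sub {m : ℕ} (a : Fin m → ℝ) :
    (Matrix.of fun i j : Fin m => Real.exp (-|a i - a j|)).PosSemidef := by
  classical
  set b : Fin m → ℝ := fun i => Real.exp (2 * a i) with hb
  have hbpos : ∀ i, 0 ≤ b i := fun i => (Real.exp_pos _).le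
  have hmin : (Matrix.of fun i j : Fin m => min (b i) (b j)).PosSemidef := by
    have hEq : (Matrix.of fun i j : Fin m => min (b i) (b j))
        = Matrix.of fun i j : Fin m => volume.real (Icc 0 (b i) ∩ Icc 0 (b j)) := by
      ext i j
      simp only [Matrix.of_apply, Icc_inter_Icc, max_self]
      rw [Real.volume_real_Icc_of_le (le_min (hbpos i) (hbpos j)), sub_zero]
    rw [hEq]
    exact posSemidef_matrix_measure_inter (fun _ => measurableSet_Icc)
      (fun _ => measure_Icc_lt_top.ne)
  set d : Fin m → ℝ := fun i => Real.exp (-a i) with hd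
  have hcong := hmin.conjTranspose_mul_mul_same (Matrix.diagonal d)
  have hEq2 : (Matrix.diagonal d)ᴴ * (Matrix.of fun i j : Fin m => min (b i) (b j)) * Matrix.diagonal d
      = Matrix.of fun i j : Fin m => Real.exp (-|a i - a j|) := by
    rw [Matrix.diagonal_conjTranspose]
    ext i j
    simp only [Matrix.mul_diagonal, Matrix.diagonal_mul, Matrix.of_apply, star_trivial]
    rcases le_total (a i) (a j) with h | h
    · have hm : min (b i) (b j) = b i := min_eq_left (Real.exp_le_exp.2 (by linarith))
      rw [hm, abs_of_nonpos (by linarith), hb, ← Real.exp_add, ← Real.exp_add]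
      congr 1; ring
    · have hm : min (b i) (b j) = b j := min_eq_right (Real.exp_le_exp.2 (by linarith))
      rw [hm, abs_of_nonneg (by linarith), hb, ← Real.exp_add, ← Real.exp_add]
      congr 1; ring
  rw [hEq2] at hcong
  exact hcong

/-- Pointwise OS-positivity of `exp (−‖·‖₁)` across `x₀ = 0`: the Gram matrix factorises as
`(e^{−tᵢ} e^{−tⱼ}) ⊙ Π_{μ=1,2,3} e^{−|aᵢμ − aⱼμ|}`, a Hadamard product of PSD matrices (Schur). [folklore] -/
theorem Kexp_axis_positive (m : ℕ) (x : Fin m → E4) (c : Fin m → ℝ) (hx : ∀ i, 0 < x i 0) :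
    0 ≤ ∑ i, ∑ j, c i * c j * Kexp (timeReflection 4 (x i) - x j) := by
  classical
  set v : Fin m → ℝ := fun i => Real.exp (-(x i 0)) with hv
  set T : Matrix (Fin m) (Fin m) ℝ := Matrix.vecMulVec v (star v) with hT
  set G : Fin 4 → Matrix (Fin m) (Fin m) ℝ := fun μ =>
    Matrix.of fun i j : Fin m => Real.exp (-|x i μ - x j μ|) with hG
  have hTpsd : T.PosSemidef := Matrix.posSemidef_vecMulVec_self_star v
  have hGpsd : ∀ μ, (G μ).PosSemidef := fun μ => posSemidef_exp_neg_abs_sub fun i => x i μ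
  have hM : (T ⊙ G 1 ⊙ G 2 ⊙ G 3).PosSemidef :=
    ((hTpsd.hadamard (hGpsd 1)).hadamard (hGpsd 2)).hadamard (hGpsd 3)
  have hentry : ∀ i j, (T ⊙ G 1 ⊙ G 2 ⊙ G 3) i j = Kexp (timeReflection 4 (x i) - x j) := by
    intro i j
    have h0 : |(-(x i 0) - x j 0)| = x i 0 + x j 0 := by
      rw [abs_of_nonpos (by linarith [hx i, hx j])]; ring
    simp only [Matrix.hadamard_apply, hT, Matrix.vecMulVec_apply, star_trivial, hG,
      Matrix.of_apply, Kexp, Fin.sum_univ_four, PiLp.sub_apply, timeReflection_apply,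
      Fin.isValue, if_true, hv]
    simp only [show ((1 : Fin 4) = 0) = False by decide, show ((2 : Fin 4) = 0) = False by decide,
      show ((3 : Fin 4) = 0) = False by decide, if_false, h0]
    rw [← Real.exp_add, ← Real.exp_add, ← Real.exp_add, ← Real.exp_add]
    congr 1; ring
  have hq := hM.dotProduct_mulVec_nonneg c
  have hexp : star c ⬝ᵥ ((T ⊙ G 1 ⊙ G 2 ⊙ G 3) *ᵥ c)
      = ∑ i, ∑ j, c i * c j * Kexp (timeReflection 4 (x i) - x j) := by
    simp only [dotProduct, Matrix.mulVec, Pi.star_apply, star_trivial, Finset.mul_sum]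
    refine Finset.sum_congr rfl fun i _ => Finset.sum_congr rfl fun j _ => ?_
    rw [hentry i j]; ring
  rw [hexp] at hq
  exact hq

/-- `Kexp` is invariant under the hyperoctahedral group `W(B₄)` (signed permutations). [folklore] -/
theorem Kexp_hypercubic (R : E4 ≃ₗᵢ[ℝ] E4)
    (hR : ∀ i : Fin 4, ∃ j : Fin 4, R (EuclideanSpace.single i 1) = EuclideanSpace.single j 1 ∨
      R (EuclideanSpace.single i 1) = -EuclideanSpace.single j 1) (x : E4) :
    Kexp (R x) = Kexp x := by
  obtain ⟨σ, s, rfl⟩ := IsSignedPermIsometry.exists_eq_signedPermIsometry hR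
  simp only [Kexp, sum_abs_signedPerm]

/-- `Kexp` is not `O(4)`-invariant: `K(e₀) = e⁻¹ ≠ e^{−√2} = K((e₀+e₁)/√2)`. [folklore] -/
theorem Kexp_not_radial : ¬ ∀ (R : E4 ≃ₗᵢ[ℝ] E4) (x : E4), x ≠ 0 → Kexp (R x) = Kexp x := by
  intro h
  set a : ℝ := 1 / Real.sqrt 2 with ha_def
  have ha2 : a ^ 2 = 1 / 2 := by
    rw [ha_def, div_pow, one_pow, Real.sq_sqrt (by norm_num : (0 : ℝ) ≤ 2)]
  have hapos : 0 < a := by rw [ha_def]; positivity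
  set v : E4 := EuclideanSpace.single 0 1 with hv
  set w : E4 := a • EuclideanSpace.single 0 1 + a • EuclideanSpace.single 1 1 with hw
  have hnorm : ‖v‖ = ‖w‖ := by
    have h1 : ‖v‖ = 1 := by rw [hv, EuclideanSpace.norm_eq]; simp
    have h2 : ‖w‖ = 1 := by
      have hsum : ∑ i : Fin 4, ‖w i‖ ^ 2 = a ^ 2 + a ^ 2 := by
        rw [hw]; simp [Fin.sum_univ_four, PiLp.single_apply]
      rw [EuclideanSpace.norm_eq, hsum, ← two_mul, ha2]; norm_num
    rw [h1, h2]
  set R : E4 ≃ₗᵢ[ℝ] E4 := (Submodule.span ℝ {v - w})ᗮ.reflection with hR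
  have hRv : R v = w := Submodule.reflection_sub hnorm
  have hv0 : v ≠ 0 := by
    intro h0
    have : v 0 = 0 := by rw [h0]; rfl
    simp [hv] at this
  have key := h R v hv0
  rw [hRv] at key
  have hlv : ∑ i, |v i| = 1 := by simp [hv, Fin.sum_univ_four, PiLp.single_apply]
  have hlw : ∑ i, |w i| = 2 * a := by
    simp [hw, Fin.sum_univ_four, PiLp.single_apply, abs_of_pos hapos]; ring
  simp only [Kexp, hlv, hlw, Real.exp_eq_exp] at key
  have h2a : (2 * a) ^ 2 = 2 := by rw [mul_pow, ha2]; norm_num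
  have : (2 * a) = 1 := by linarith
  rw [this] at h2a
  norm_num at h2a

/-- The crux `ShellRigidity` with the DIAGONAL positivity hypothesis (`x₀ = x₁` mirror) DROPPED;
everything else verbatim. -/
def ShellRigidityWithoutDiag : Prop :=
  ∀ (K : E4 → ℝ), ContinuousOn K {x : E4 | x ≠ 0} →
    (∃ C η : ℝ, 0 < η ∧ ∀ x : E4, x ≠ 0 → |K x| ≤ C * (1 + ‖x‖ ^ (η - 10))) →
    (∀ R : E4 ≃ₗᵢ[ℝ] E4, (∀ i : Fin 4, ∃ j : Fin 4, R (EuclideanSpace.single i 1) =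
      EuclideanSpace.single j 1 ∨ R (EuclideanSpace.single i 1) = -EuclideanSpace.single j 1) →
      ∀ x : E4, K (R x) = K x) →
    (∀ (m : ℕ) (x : Fin m → E4) (c : Fin m → ℝ), (∀ i, 0 < x i 0) →
      0 ≤ ∑ i, ∑ j, c i * c j * K (timeReflection 4 (x i) - x j)) →
    ∀ (R : E4 ≃ₗᵢ[ℝ] E4) (x : E4), x ≠ 0 → K (R x) = K x

/-- **The diagonal mirror is load-bearing**: `exp (−‖x‖₁)` is `W(B₄)`-invariant, bounded by `1`
(so the growth clause holds with `C = 1`, `η = 1`), continuous, OS-positive across all four axis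
mirrors, and not radial. Any proof of the crux must use positivity across `x₀ = x₁`. [folklore] -/
theorem shellRigidity_false_without_diag : ¬ ShellRigidityWithoutDiag := by
  intro hS
  have hcont : Continuous Kexp := by
    refine Real.continuous_exp.comp (Continuous.neg ?_)
    refine continuous_finsetSum _ fun i _ => ?_
    exact (PiLp.continuous_apply 2 (fun _ : Fin 4 => ℝ) i).abs
  refine Kexp_not_radial (hS Kexp hcont.continuousOn ⟨1, 1, one_pos, fun x _ => ?_⟩
    (fun R hR x => Kexp_hypercubic R hR x) (fun m x c hx => Kexp_axis_positive m x c hx))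
  have hr : (0 : ℝ) ≤ ‖x‖ ^ ((1 : ℝ) - 10) := Real.rpow_nonneg (norm_nonneg _) _
  have hK1 : |Kexp x| ≤ 1 := by
    rw [Kexp, abs_of_pos (Real.exp_pos _), ← Real.exp_zero]
    exact Real.exp_le_exp.2 (by linarith [Finset.sum_nonneg fun i (_ : i ∈ Finset.univ) => abs_nonneg (x i)])
  linarith

end

end Summit.QuantumFields.YangMills.Theorems.ShellRigidity.Negative
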